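import Summits.Ventures.Crystal3D.Theorems.StickyWulffConstantCoaxialWallLawJammedBall
import HarnessLib

/-!
# A QUIET SET OF BALLS only re-weights pools: the set version of `…JammedBall` (crux `CoaxialWallLaw`, stmt-Ventures-19481; line `WallLedgerF`,
# skeleton 'CoaxialWallLawCertificates' v5, stub `stub_seamResidual` — the «quiet second fragment» layer of the seam residual)

HONEST FRAMING. Venture `Summits/Ventures/Crystal3D` (cell `crystal3d-full`), helper `--supports` the crux `CoaxialWallLaw` of
`route-Ventures-StickyWulffConstant` (REGISTERED line `WallLedgerF`, skeleton 'Certificates' v5).  Rung credit only; F-C1 not moved; census-free.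
`…JammedBall` compared `X` with `X.erase x` for ONE ball `x` that sits at no inspected position of the (A)-pairs near the payer; by `…MonoOfNonCapping` the
seam residue always contains a second READ FRAGMENT, i.e. a whole SET `J` of foreign balls.  This file is the set version: a subset `J ⊆ X` (payer `z ∉ J`)
is QUIET when no (A)-end pair `(b, q)` of a ball `b ∉ J` within `1` of the payer has its reader in `J` or inspects a ball of `J` (`InspectedAt`).  Then
removing `J` keeps every such end pair (`isEndPairA_sdiff_of_quiet`), so `endMultA X b ≤ endMultA (X \ J) b` for `b ∉ J` (`endMultA_le_sdiff`), and the
pools change only by healing and by the foreign balls' own deficiency (`pooledDef_sdiff_le`):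
`pooledDef (X \ J) b + Σ_{x ∈ J, dist b x ≤ 1, deg x ≤ 11} (12 − deg x) ≤ pooledDef X b + heal_J(b)`, `heal_J(b) = #{(x, y) : x ∈ J, y ∈ X \ J, dist x y = 1, dist b y ≤ 1}`.
* **`localSummandA_le_of_quiet_set`** — `Σ_A(X, z) ≤ Σ_{b ∉ J} e'(b) / (p'(b) − heal_J(b) + def_J(b)) + Σ_{b ∈ J} e_X(b) / p_X(b)`: the core part is a
  RE-EVALUATION of the window `X \ J` (on-site in the application), the foreign part is the load of the payer by end balls OF the fragment (which touch the
  payer — a contact across the seam).  GENERIC seams (no contact / coincidence within `2` of the payer) have `heal = 0`, empty foreign part, and are in fact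
  `HasDeletionOnSite`; the census/motif inputs of the seam residual are about the NON-generic (contact-pinned) ones.
WHAT THIS IS NOT: not the seam bound; the quietness hypothesis is abstract here (discharged per regime elsewhere); F-C1 not moved.
-/

noncomputable section

namespace Summit.Ventures.Crystal3D.Theorems

namespace TailResidue

open Summit.Ventures.Crystal3D Finset
open scoped InnerProductSpace

section Quiet

variable {X J : Finset (EuclideanSpace ℝ (Fin 3))} {v : WordVersion} {S₁ S₂ : PlateSystem} {z : EuclideanSpace ℝ (Fin 3)}
  (hX : ∀ p ∈ X, ∀ q ∈ X, p ≠ q → 1 ≤ dist p q) (h₁ : S₁.RT ⊆ fccSlots) (h₂ : S₂.RT ⊆ fccSlots) (hJ : J ⊆ X)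
  (hquiet : ∀ b ∈ X, b ∉ J → dist z b ≤ 1 → ∀ q ∈ X, ∀ G : EuclideanSpace ℝ (Fin 3) ≃ₗᵢ[ℝ] EuclideanSpace ℝ (Fin 3), ∀ d : EuclideanSpace ℝ (Fin 3),
    (S₁.Adm G d ∨ S₂.Adm G d) → IsEndMove X v G d q b → q ∉ J ∧ ∀ x ∈ J, ¬ InspectedAt G q b x)

include h₁ h₂ hX hquiet in
open scoped Classical in
/-- **An (A)-end pair of a ball outside the quiet set, within `1` of the payer, survives the removal of the set.** -/
theorem isEndPairA_sdiff_of_quiet {b q : EuclideanSpace ℝ (Fin 3)} (hbJ : b ∉ J) (hzb : dist z b ≤ 1) (h : IsEndPairA X v S₁ S₂ b q) :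
    IsEndPairA (X \ J) v S₁ S₂ b q := by
  obtain ⟨hq, hb, hpay, G, d, hadm, hpred, hmove⟩ := h
  obtain ⟨hqJ, hni⟩ := hquiet b hb hbJ hzb q hq G d hadm hmove
  have hbE : b ∈ X \ J := mem_sdiff.2 ⟨hb, hbJ⟩
  have hEX : X \ J ⊆ X := sdiff_subset
  -- membership transfer for non-inspected / non-`J` balls
  have keep : ∀ {y}, y ∈ X → y ∉ J → y ∈ X \ J := fun hy hyJ => mem_sdiff.2 ⟨hy, hyJ⟩
  refine ⟨keep hq hqJ, hbE, ?_, G, d, hadm, ?_, ?_⟩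
  · -- two-payer clause: degrees only drop; if a payer witness is removed, `b` itself becomes deficient
    have hdeg : ∀ y, ((X \ J).filter fun q => dist y q = 1).card ≤ (X.filter fun q => dist y q = 1).card :=
      fun y => card_le_card (fun p hp => by rw [mem_filter] at hp ⊢; exact ⟨(mem_sdiff.1 hp.1).1, hp.2⟩)
    rcases hpay with hle | ⟨z₁, hz₁, z₂, hz₂, hne, hd₁, hd₂, hdeg₁, hdeg₂⟩
    · exact Or.inl ((hdeg b).trans hle)
    · have drop : ∀ {w}, w ∈ X → w ∈ J → dist b w = 1 → ((X \ J).filter fun q => dist b q = 1).card ≤ 11 := by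
        intro w hw hwJ hd
        have hwmem : w ∈ X.filter fun q => dist b q = 1 := mem_filter.2 ⟨hw, hd⟩
        have hsub : (X \ J).filter (fun q => dist b q = 1) ⊆ (X.filter fun q => dist b q = 1).erase w := by
          intro p hp; rw [mem_filter] at hp
          exact mem_erase.2 ⟨fun h => (mem_sdiff.1 hp.1).2 (h ▸ hwJ), mem_filter.2 ⟨(mem_sdiff.1 hp.1).1, hp.2⟩⟩
        have h12 := card_filter_dist_eq_one_le_twelve X hX b
        have hc := card_le_card hsub
        rw [card_erase_of_mem hwmem] at hc
        omega
      by_cases hJ₁ : z₁ ∈ J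
      · exact Or.inl (drop hz₁ hJ₁ hd₁)
      by_cases hJ₂ : z₂ ∈ J
      · exact Or.inl (drop hz₂ hJ₂ hd₂)
      exact Or.inr ⟨z₁, keep hz₁ hJ₁, z₂, keep hz₂ hJ₂, hne, hd₁, hd₂, (hdeg z₁).trans hdeg₁, (hdeg z₂).trans hdeg₂⟩
  · -- the predecessor is a dozen position of `q`
    obtain ⟨w₀, hw₀, hdw⟩ : ∃ w₀ ∈ fccSlots, -d = G w₀ := by
      rcases hadm with h | h
      · exact (exists_slots_of_adm h₁ h).2
      · exact (exists_slots_of_adm h₂ h).2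
    refine keep hpred fun hJmem => hni _ hJmem ⟨w₀, hw₀, Or.inl ?_⟩
    rw [sub_eq_add_neg, hdw]
  · exact isEndMove_of_exact hEX hmove hbE fun y hy hiy => keep hy fun hyJ => hni y hyJ hiy

include h₁ h₂ hX hquiet in
open scoped Classical in
/-- **End multiplicities of balls outside the quiet set only grow when the set is removed** (readers are outside `J` by quietness). -/
theorem endMultA_le_sdiff {b : EuclideanSpace ℝ (Fin 3)} (hbJ : b ∉ J) (hzb : dist z b ≤ 1) :
    endMultA X v S₁ S₂ b ≤ endMultA (X \ J) v S₁ S₂ b := by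
  unfold endMultA
  refine card_le_card fun q hq => ?_
  rw [mem_filter] at hq ⊢
  have hp := isEndPairA_sdiff_of_quiet hX h₁ h₂ hquiet hbJ hzb hq.2
  exact ⟨hp.1, hp⟩

include hX hJ in
open scoped Classical in
/-- **POOLS UNDER REMOVAL OF A SET**: `pooledDef (X \ J) b + Σ_{x ∈ J, dist b x ≤ 1, deg x ≤ 11} (12 − deg x) ≤ pooledDef X b + heal_J(b)`,
`heal_J(b) = #{(y, x) : y ∈ X \ J, x ∈ J, dist y x = 1, dist b y ≤ 1}` (each foreign contact heals one unit of one kept ball). -/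
theorem pooledDef_sdiff_le (b : EuclideanSpace ℝ (Fin 3)) :
    pooledDef (X \ J) b +
        ∑ x ∈ J.filter (fun x => dist b x ≤ 1 ∧ (X.filter fun q => dist x q = 1).card ≤ 11), ((12 : ℝ) - ((X.filter fun q => dist x q = 1).card : ℝ)) ≤
      pooledDef X b + ((((X \ J).filter fun y => dist b y ≤ 1) ×ˢ J).filter fun p => dist p.1 p.2 = 1).card := by
  -- degrees: `deg_X y = deg_{X∖J} y + #(J-contacts of y)` for `y ∉ J`
  have hdegsplit : ∀ y, (X.filter fun q => dist y q = 1).card =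
      ((X \ J).filter fun q => dist y q = 1).card + (J.filter fun q => dist y q = 1).card := by
    intro y
    have hu : X.filter (fun q => dist y q = 1) = (X \ J).filter (fun q => dist y q = 1) ∪ J.filter (fun q => dist y q = 1) := by
      ext q; simp only [mem_filter, mem_union, mem_sdiff]
      constructor
      · rintro ⟨hq, hd⟩; by_cases hqJ : q ∈ J
        · exact Or.inr ⟨hqJ, hd⟩
        · exact Or.inl ⟨⟨hq, hqJ⟩, hd⟩
      · rintro (⟨⟨hq, -⟩, hd⟩ | ⟨hqJ, hd⟩)
        · exact ⟨hq, hd⟩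
        · exact ⟨hJ hqJ, hd⟩
    rw [hu, card_union_of_disjoint]
    exact disjoint_left.2 fun q hq hq' => (mem_sdiff.1 (mem_filter.1 hq).1).2 (mem_filter.1 hq').1
  -- pool index sets
  set PX := X.filter (fun y => dist b y ≤ 1 ∧ (X.filter fun q => dist y q = 1).card ≤ 11) with hPX
  set P' := (X \ J).filter (fun y => dist b y ≤ 1 ∧ ((X \ J).filter fun q => dist y q = 1).card ≤ 11) with hP'
  set PJ := J.filter (fun x => dist b x ≤ 1 ∧ (X.filter fun q => dist x q = 1).card ≤ 11) with hPJ
  -- term functions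
  set fX : EuclideanSpace ℝ (Fin 3) → ℝ := fun y =>
    if (X.filter fun q => dist y q = 1).card ≤ 11 then (12 : ℝ) - ((X.filter fun q => dist y q = 1).card : ℝ) else 0 with hfX
  set hl : EuclideanSpace ℝ (Fin 3) → ℝ := fun y => ((J.filter fun q => dist y q = 1).card : ℝ) with hhl
  have hfXnn : ∀ y, 0 ≤ fX y := fun y => by
    simp only [hfX]; split_ifs with h
    · have : ((X.filter fun q => dist y q = 1).card : ℝ) ≤ 11 := by exact_mod_cast h
      linarith
    · exact le_rfl
  -- termwise on `P'`: `12 − deg' y ≤ fX y + heal(y)`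
  have hterm : ∀ y ∈ P', (12 : ℝ) - (((X \ J).filter fun q => dist y q = 1).card : ℝ) ≤ fX y + hl y := by
    intro y hy
    obtain ⟨-, -, hdeg'⟩ := mem_filter.1 hy
    have hs := hdegsplit y
    simp only [hfX, hhl]
    split_ifs with hle
    · have : ((X.filter fun q => dist y q = 1).card : ℝ) = (((X \ J).filter fun q => dist y q = 1).card : ℝ) +
          ((J.filter fun q => dist y q = 1).card : ℝ) := by exact_mod_cast hs
      linarith
    · have h12 := card_filter_dist_eq_one_le_twelve X hX y
      have hx12 : (X.filter fun q => dist y q = 1).card = 12 := by omega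
      have : (((X \ J).filter fun q => dist y q = 1).card : ℝ) + ((J.filter fun q => dist y q = 1).card : ℝ) = 12 := by
        rw [hx12] at hs; exact_mod_cast hs.symm
      linarith
  have hdef' : pooledDef (X \ J) b = ∑ y ∈ P', ((12 : ℝ) - (((X \ J).filter fun q => dist y q = 1).card : ℝ)) := by unfold pooledDef; rfl
  have hsum : pooledDef (X \ J) b ≤ ∑ y ∈ P', fX y + ∑ y ∈ P', hl y := by
    rw [hdef', ← sum_add_distrib]; exact sum_le_sum hterm
  -- the kept part and the foreign part of the pool of `X`
  have hpoolX : pooledDef X b = ∑ y ∈ PX, fX y := by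
    unfold pooledDef; exact sum_congr rfl fun y hy => by simp only [hfX, if_pos (mem_filter.1 hy).2.2]
  have hsplitX : ∑ y ∈ PX, fX y = ∑ y ∈ PX.filter (fun y => y ∉ J), fX y + ∑ y ∈ PX.filter (fun y => y ∈ J), fX y := by
    rw [← sum_filter_add_sum_filter_not PX (fun y => y ∉ J)]
    congr 1
    exact sum_congr (filter_congr fun y _ => by simp only [not_not]) fun _ _ => rfl
  -- kept part dominates `∑ P' fX`
  have hkept : ∑ y ∈ P', fX y ≤ ∑ y ∈ PX.filter (fun y => y ∉ J), fX y := by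
    calc ∑ y ∈ P', fX y = ∑ y ∈ P'.filter (fun y => (X.filter fun q => dist y q = 1).card ≤ 11), fX y +
          ∑ y ∈ P'.filter (fun y => ¬ (X.filter fun q => dist y q = 1).card ≤ 11), fX y := (sum_filter_add_sum_filter_not _ _ _).symm
      _ = ∑ y ∈ P'.filter (fun y => (X.filter fun q => dist y q = 1).card ≤ 11), fX y := by
          rw [add_eq_left]; exact sum_eq_zero fun y hy => by simp only [hfX, if_neg (mem_filter.1 hy).2]
      _ ≤ ∑ y ∈ PX.filter (fun y => y ∉ J), fX y := by
          refine sum_le_sum_of_subset_of_nonneg (fun y hy => ?_) fun y _ _ => hfXnn y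
          obtain ⟨hyP, hle⟩ := mem_filter.1 hy
          obtain ⟨hyE, hby, -⟩ := mem_filter.1 hyP
          exact mem_filter.2 ⟨mem_filter.2 ⟨(mem_sdiff.1 hyE).1, hby, hle⟩, (mem_sdiff.1 hyE).2⟩
  -- foreign part equals the claimed foreign sum
  have hforeign : ∑ x ∈ PJ, ((12 : ℝ) - ((X.filter fun q => dist x q = 1).card : ℝ)) = ∑ y ∈ PX.filter (fun y => y ∈ J), fX y := by
    have hset : PJ = PX.filter (fun y => y ∈ J) := by
      ext y; simp only [hPJ, hPX, mem_filter]
      constructor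
      · rintro ⟨hyJ, hby, hle⟩; exact ⟨⟨hJ hyJ, hby, hle⟩, hyJ⟩
      · rintro ⟨⟨-, hby, hle⟩, hyJ⟩; exact ⟨hyJ, hby, hle⟩
    rw [hset]
    exact sum_congr rfl fun y hy => by simp only [hfX, if_pos (mem_filter.1 (mem_filter.1 hy).1).2.2]
  -- healing count
  have hheal : ∑ y ∈ P', hl y ≤ (((((X \ J).filter fun y => dist b y ≤ 1) ×ˢ J).filter fun p => dist p.1 p.2 = 1).card : ℝ) := by
    have hle : ∑ y ∈ P', hl y ≤ ∑ y ∈ (X \ J).filter (fun y => dist b y ≤ 1), hl y :=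
      sum_le_sum_of_subset_of_nonneg (fun y hy => mem_filter.2 ⟨(mem_filter.1 hy).1, (mem_filter.1 hy).2.1⟩) fun _ _ _ => Nat.cast_nonneg _
    refine hle.trans (le_of_eq ?_)
    rw [card_filter, sum_product]
    push_cast
    refine sum_congr rfl fun y _ => ?_
    simp only [hhl, card_filter]
    push_cast
    rfl
  rw [hpoolX, hsplitX, ← hforeign]
  linarith


include hX h₁ h₂ hJ hquiet in
open scoped Classical in
/-- **THE QUIET-SET COMPARISON.**  Write `e', p'` for the (A)-multiplicities and pools of `X \ J`, `heal(b)` for the number of (kept, foreign) contacts with the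
kept ball within `1` of `b`, and `def(b)` for the total deficiency of the foreign balls within `1` of `b`.  If every `p'(b) − heal(b) + def(b)` at a kept ball
within `1` of the payer is positive, then
`Σ_A(X, z) ≤ Σ_{b ∉ J} e'(b) / (p'(b) − heal(b) + def(b)) + Σ_{b ∈ J} e_X(b) / p_X(b)` (both sums over balls within `1` of the payer). -/
theorem localSummandA_le_of_quiet_set (hzJ : z ∉ J)
    (hpos : ∀ b ∈ X \ J, dist z b ≤ 1 →
      0 < pooledDef (X \ J) b - (((((X \ J).filter fun y => dist b y ≤ 1) ×ˢ J).filter fun p => dist p.1 p.2 = 1).card : ℝ) +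
        ∑ x ∈ J.filter (fun x => dist b x ≤ 1 ∧ (X.filter fun q => dist x q = 1).card ≤ 11), ((12 : ℝ) - ((X.filter fun q => dist x q = 1).card : ℝ))) :
    localSummandA v S₁ S₂ X z ≤
      (∑ b ∈ (X \ J).filter (fun b => dist z b ≤ 1 ∧ 0 < endMultA (X \ J) v S₁ S₂ b),
        (endMultA (X \ J) v S₁ S₂ b : ℝ) /
          (pooledDef (X \ J) b - (((((X \ J).filter fun y => dist b y ≤ 1) ×ˢ J).filter fun p => dist p.1 p.2 = 1).card : ℝ) +
            ∑ x ∈ J.filter (fun x => dist b x ≤ 1 ∧ (X.filter fun q => dist x q = 1).card ≤ 11), ((12 : ℝ) - ((X.filter fun q => dist x q = 1).card : ℝ)))) +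
      ∑ b ∈ J.filter (fun b => dist z b ≤ 1 ∧ 0 < endMultA X v S₁ S₂ b), (endMultA X v S₁ S₂ b : ℝ) / pooledDef X b := by
  have _ := hzJ
  unfold localSummandA
  set A := X.filter (fun b => dist z b ≤ 1 ∧ 0 < endMultA X v S₁ S₂ b) with hA
  set A' := (X \ J).filter (fun b => dist z b ≤ 1 ∧ 0 < endMultA (X \ J) v S₁ S₂ b) with hA'
  set AJ := J.filter (fun b => dist z b ≤ 1 ∧ 0 < endMultA X v S₁ S₂ b) with hAJ
  set D : EuclideanSpace ℝ (Fin 3) → ℝ := fun b =>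
    pooledDef (X \ J) b - (((((X \ J).filter fun y => dist b y ≤ 1) ×ˢ J).filter fun p => dist p.1 p.2 = 1).card : ℝ) +
      ∑ x ∈ J.filter (fun x => dist b x ≤ 1 ∧ (X.filter fun q => dist x q = 1).card ≤ 11), ((12 : ℝ) - ((X.filter fun q => dist x q = 1).card : ℝ))
    with hD
  set g : EuclideanSpace ℝ (Fin 3) → ℝ := fun b => (endMultA (X \ J) v S₁ S₂ b : ℝ) / D b with hg
  set f : EuclideanSpace ℝ (Fin 3) → ℝ := fun b => (endMultA X v S₁ S₂ b : ℝ) / pooledDef X b with hf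
  -- split the loaded balls into kept and foreign
  have hsplit : ∑ b ∈ A, f b = ∑ b ∈ A.filter (fun b => b ∉ J), f b + ∑ b ∈ A.filter (fun b => b ∈ J), f b := by
    rw [← sum_filter_add_sum_filter_not A (fun b => b ∉ J)]
    congr 1
    exact sum_congr (filter_congr fun y _ => by simp only [not_not]) fun _ _ => rfl
  -- kept balls: termwise comparison and inclusion into `A'`
  have key : ∀ b ∈ A.filter (fun b => b ∉ J), b ∈ A' ∧ f b ≤ g b := by
    intro b hb
    obtain ⟨hbA, hbJ⟩ := mem_filter.1 hb
    obtain ⟨hbX, hzb, hepos⟩ := mem_filter.1 hbA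
    have hbE : b ∈ X \ J := mem_sdiff.2 ⟨hbX, hbJ⟩
    have hle := endMultA_le_sdiff hX h₁ h₂ hquiet (v := v) hbJ hzb
    have hp := pooledDef_sdiff_le hX hJ b
    have hDpos : 0 < D b := hpos b hbE hzb
    have hDle : D b ≤ pooledDef X b := by simp only [hD]; linarith
    refine ⟨mem_filter.2 ⟨hbE, hzb, lt_of_lt_of_le hepos hle⟩, ?_⟩
    have hleR : (endMultA X v S₁ S₂ b : ℝ) ≤ (endMultA (X \ J) v S₁ S₂ b : ℝ) := by exact_mod_cast hle
    calc f b = (endMultA X v S₁ S₂ b : ℝ) / pooledDef X b := rfl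
      _ ≤ (endMultA (X \ J) v S₁ S₂ b : ℝ) / pooledDef X b := div_le_div_of_nonneg_right hleR (hDpos.le.trans hDle)
      _ ≤ g b := div_le_div_of_nonneg_left (Nat.cast_nonneg _) hDpos hDle
  have hgnn : ∀ b ∈ A', 0 ≤ g b := fun b hb =>
    div_nonneg (Nat.cast_nonneg _) (hpos b (mem_filter.1 hb).1 (mem_filter.1 hb).2.1).le
  have h1 : ∑ b ∈ A.filter (fun b => b ∉ J), f b ≤ ∑ b ∈ A', g b :=
    (sum_le_sum fun b hb => (key b hb).2).trans (sum_le_sum_of_subset_of_nonneg (fun b hb => (key b hb).1) fun b hb _ => hgnn b hb)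
  -- foreign balls: the same terms
  have h2 : ∑ b ∈ A.filter (fun b => b ∈ J), f b = ∑ b ∈ AJ, f b := by
    refine sum_congr ?_ fun _ _ => rfl
    ext b; simp only [hA, hAJ, mem_filter]
    constructor
    · rintro ⟨⟨-, hzb, he⟩, hbJ⟩; exact ⟨hbJ, hzb, he⟩
    · rintro ⟨hbJ, hzb, he⟩; exact ⟨⟨hJ hbJ, hzb, he⟩, hbJ⟩
  rw [hsplit, h2]
  linarith

end Quiet

end TailResidue

end Summit.Ventures.Crystal3D.Theorems

end
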